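import Summits.AnomalousDissipation.AnomalousDissipation.Theorems.SawtoothPulseCascadeK1LocalisedCascadeBlockKernel

/-!
# K1loc, line `Spectral` / thin start — helper: PER-FIBRE KERNEL CONSTANTS OF A FIBRE BLOCK, SHARP (log) FORM

Helper file of the prover lane on the crux `K1LocalisedCascade` (stmt-AnomalousDissipation-19491), route `SawtoothPulseCascade`
(S-B/S-C assembly seat; the LEDGER ASSEMBLY, block layer, Log2 grade).  The sharp window theorems
`…ClassStepVLog2/HLog2.sum_window_iterate_{v,h}step_le_log2` ask, fibre by fibre on a block `Λ ≤ |n|`, for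
`4/π + (2/π)·log((p(n)+|n|G)/(|n|G−p(n))) + 1/(|n|G−p(n)) + 1/(π(|n|G−p(n))²) ≤ A` and `1/(2(|n|G−p(n))) ≤ τ`.  This file derives
them from the plain facts of `…BlockKernel` (the log is monotone; the denominator `|n|G − p(n)` is bounded below on the block):
* §1 ratio window, plateau `⌊v|n|/u⌋ + Q₂`: `ratioKernel_den_ge` (`((uG−v)Λ − uQ₂)/u ≤ |n|G − p(n)`), `ratioKernel_log_le`
  (`A_log = 4/π + (2/π)log(((v+uG)Λ+uQ₂)/((uG−v)Λ−uQ₂)) + u/((uG−v)Λ−uQ₂) + u²/(π((uG−v)Λ−uQ₂)²)`), `ratioKernel_tauLog_le`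
  (`τ_log = u/(2((uG−v)Λ−uQ₂))`);
* §2 strip window, plateau `K + Q₂`: `stripKernel_log_le` (`A_log = 4/π + (2/π)log((K+Q₂+ΛG)/(ΛG−K−Q₂)) + 1/(ΛG−K−Q₂) + 1/(π(ΛG−K−Q₂)²)`),
  `stripKernel_tauLog_le` (`τ_log = 1/(2(ΛG−K−Q₂))`).
Pure arithmetic; no definitions; no statement about the crux. [cite: Grafakos2014, §3.1.3] [problem: turb]
-/

-- `Summit.<Summit>.<Problem>`: single-conjunct summit, the duplicate namespace segment is deliberate.
set_option linter.dupNamespace false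

noncomputable section

namespace Summit.AnomalousDissipation.AnomalousDissipation.Theorems.SawtoothPulseCascade.K1Window

/-- Monotonicity of the log-form kernel constant `x ↦ 4/π + (2/π)log x` composed with `D ↦ 1/D + 1/(πD²)`: if `0 < x ≤ x'` and
`0 < D' ≤ D` then `4/π + (2/π)log x + 1/D + 1/(πD²) ≤ 4/π + (2/π)log x' + 1/D' + 1/(πD'²)`. [folklore] -/
theorem logKernel_mono {x x' D D' : ℝ} (hx : 0 < x) (hxx' : x ≤ x') (hD' : 0 < D') (hDD' : D' ≤ D) :
    4 / Real.pi + 2 / Real.pi * Real.log x + 1 / D + 1 / (Real.pi * D ^ 2) ≤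
      4 / Real.pi + 2 / Real.pi * Real.log x' + 1 / D' + 1 / (Real.pi * D' ^ 2) := by
  have hπ := Real.pi_pos
  have h1 : Real.log x ≤ Real.log x' := Real.log_le_log hx hxx'
  have hD : 0 < D := lt_of_lt_of_le hD' hDD'
  have h2 : 1 / D ≤ 1 / D' := one_div_le_one_div_of_le hD' hDD'
  have h3 : 1 / (Real.pi * D ^ 2) ≤ 1 / (Real.pi * D' ^ 2) :=
    one_div_le_one_div_of_le (by positivity) (mul_le_mul_of_nonneg_left (pow_le_pow_left₀ hD'.le hDD' 2) hπ.le)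
  have h4 : 2 / Real.pi * Real.log x ≤ 2 / Real.pi * Real.log x' := mul_le_mul_of_nonneg_left h1 (by positivity)
  linarith

/-! ## §1 The ratio window -/

/-- **The block denominator bounds the fibre denominators from below**: with `p(n) = ⌊v|n|/u⌋ + Q₂` and `|n| ≥ Λ`,
`((uG−v)Λ − uQ₂)/u ≤ |n|G − p(n)`. [folklore] -/
theorem ratioKernel_den_ge {u v G Q₂ Λ : ℕ} (hu : 0 < u) (hvu : v < u * G) {n : ℤ} (hn : (Λ : ℤ) ≤ |n|) :
    (((u : ℝ) * G - v) * Λ - u * Q₂) / u ≤ ((n.natAbs * G : ℕ) : ℝ) - ((v * n.natAbs / u + Q₂ : ℕ) : ℝ) := by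
  have hur : (0 : ℝ) < u := by exact_mod_cast hu
  have hc2 : (0 : ℝ) ≤ (u : ℝ) * G - v := by
    have : (v : ℝ) < (u : ℝ) * G := by exact_mod_cast hvu
    linarith
  have hx : (Λ : ℝ) ≤ (n.natAbs : ℝ) := by
    have h1 : Λ ≤ n.natAbs := by rw [← Int.natCast_natAbs] at hn; exact_mod_cast hn
    exact_mod_cast h1
  have hup : (u : ℝ) * ((v * n.natAbs / u + Q₂ : ℕ) : ℝ) ≤ (v : ℝ) * (n.natAbs : ℝ) + u * Q₂ := by
    have h : u * (v * n.natAbs / u + Q₂) ≤ v * n.natAbs + u * Q₂ := by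
      have hdiv : u * (v * n.natAbs / u) ≤ v * n.natAbs := Nat.mul_div_le _ _
      rw [Nat.mul_add]; exact Nat.add_le_add_right hdiv _
    exact_mod_cast h
  have hnG : ((n.natAbs * G : ℕ) : ℝ) = (n.natAbs : ℝ) * G := by push_cast; rfl
  rw [hnG, div_le_iff₀ hur]
  nlinarith [mul_le_mul_of_nonneg_left hx hc2]

/-- **The log-form trapezoid constant of a fibre block (ratio window)**: every fibre `|n| ≥ Λ` has
`4/π + (2/π)log((p(n)+|n|G)/(|n|G−p(n))) + 1/(|n|G−p(n)) + 1/(π(|n|G−p(n))²) ≤ A_log(Λ)` (see the file header). [folklore] -/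
theorem ratioKernel_log_le {u v G Q₂ Λ : ℕ} (hu : 0 < u) (hvu : v < u * G) (hΛQ : u * Q₂ < Λ * (u * G - v))
    {n : ℤ} (hn : (Λ : ℤ) ≤ |n|) :
    4 / Real.pi + 2 / Real.pi * Real.log ((((v * n.natAbs / u + Q₂ : ℕ) : ℝ) + ((n.natAbs * G : ℕ) : ℝ)) /
        (((n.natAbs * G : ℕ) : ℝ) - ((v * n.natAbs / u + Q₂ : ℕ) : ℝ))) +
      1 / (((n.natAbs * G : ℕ) : ℝ) - ((v * n.natAbs / u + Q₂ : ℕ) : ℝ)) +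
      1 / (Real.pi * (((n.natAbs * G : ℕ) : ℝ) - ((v * n.natAbs / u + Q₂ : ℕ) : ℝ)) ^ 2) ≤
    4 / Real.pi + 2 / Real.pi * Real.log ((((v : ℝ) + u * G) * Λ + u * Q₂) / (((u : ℝ) * G - v) * Λ - u * Q₂)) +
      1 / ((((u : ℝ) * G - v) * Λ - u * Q₂) / u) + 1 / (Real.pi * ((((u : ℝ) * G - v) * Λ - u * Q₂) / u) ^ 2) := by
  have hur : (0 : ℝ) < u := by exact_mod_cast hu
  have hΛr : (u : ℝ) * Q₂ < ((u : ℝ) * G - v) * Λ := by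
    have h1 : ((u * Q₂ : ℕ) : ℝ) < ((Λ * (u * G - v) : ℕ) : ℝ) := by exact_mod_cast hΛQ
    rw [Nat.cast_mul, Nat.cast_mul, Nat.cast_sub hvu.le, Nat.cast_mul] at h1
    linarith
  have hD' : 0 < (((u : ℝ) * G - v) * Λ - u * Q₂) / u := div_pos (by linarith) hur
  have hden := ratioKernel_den_ge (Q₂ := Q₂) hu hvu hn
  have hratio := ratioKernel_ratio_le hu hvu hΛQ hn
  -- the fibre ratio is positive: numerator > 0 (it contains `|n|G ≥ ΛG > 0`), denominator > 0
  have hDn : 0 < ((n.natAbs * G : ℕ) : ℝ) - ((v * n.natAbs / u + Q₂ : ℕ) : ℝ) := lt_of_lt_of_le hD' hden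
  have hx : 0 < (((v * n.natAbs / u + Q₂ : ℕ) : ℝ) + ((n.natAbs * G : ℕ) : ℝ)) /
      (((n.natAbs * G : ℕ) : ℝ) - ((v * n.natAbs / u + Q₂ : ℕ) : ℝ)) := by
    refine div_pos ?_ hDn
    have : (0 : ℝ) ≤ ((v * n.natAbs / u + Q₂ : ℕ) : ℝ) := by positivity
    linarith
  exact logKernel_mono hx hratio hD' hden

/-- **The sharp kernel layer of a fibre block (ratio window)**: `1/(2(|n|G − p(n))) ≤ u/(2((uG−v)Λ − uQ₂))` for `|n| ≥ Λ`. [folklore] -/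
theorem ratioKernel_tauLog_le {u v G Q₂ Λ : ℕ} (hu : 0 < u) (hvu : v < u * G) (hΛQ : u * Q₂ < Λ * (u * G - v))
    {n : ℤ} (hn : (Λ : ℤ) ≤ |n|) :
    1 / (2 * (((n.natAbs * G : ℕ) : ℝ) - ((v * n.natAbs / u + Q₂ : ℕ) : ℝ))) ≤
      (u : ℝ) / (2 * (((u : ℝ) * G - v) * Λ - u * Q₂)) := by
  have hur : (0 : ℝ) < u := by exact_mod_cast hu
  have hΛr : (u : ℝ) * Q₂ < ((u : ℝ) * G - v) * Λ := by
    have h1 : ((u * Q₂ : ℕ) : ℝ) < ((Λ * (u * G - v) : ℕ) : ℝ) := by exact_mod_cast hΛQ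
    rw [Nat.cast_mul, Nat.cast_mul, Nat.cast_sub hvu.le, Nat.cast_mul] at h1
    linarith
  have hD' : 0 < (((u : ℝ) * G - v) * Λ - u * Q₂) / u := div_pos (by linarith) hur
  have hden := ratioKernel_den_ge (Q₂ := Q₂) hu hvu hn
  calc 1 / (2 * (((n.natAbs * G : ℕ) : ℝ) - ((v * n.natAbs / u + Q₂ : ℕ) : ℝ)))
      ≤ 1 / (2 * ((((u : ℝ) * G - v) * Λ - u * Q₂) / u)) :=
        one_div_le_one_div_of_le (by positivity) (by linarith)
    _ = (u : ℝ) / (2 * (((u : ℝ) * G - v) * Λ - u * Q₂)) := by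
        field_simp

/-! ## §2 The strip / low-fibre window -/

/-- **The log-form trapezoid constant of a fibre block (strip window)**: with `p = K + Q₂ < ΛG` and `|n| ≥ Λ`,
`4/π + (2/π)log((p+|n|G)/(|n|G−p)) + 1/(|n|G−p) + 1/(π(|n|G−p)²) ≤ 4/π + (2/π)log((p+ΛG)/(ΛG−p)) + 1/(ΛG−p) + 1/(π(ΛG−p)²)`.
[folklore] -/
theorem stripKernel_log_le {K G Q₂ Λ : ℕ} (hΛ : K + Q₂ < Λ * G) {n : ℤ} (hn : (Λ : ℤ) ≤ |n|) :
    4 / Real.pi + 2 / Real.pi * Real.log ((((K + Q₂ : ℕ) : ℝ) + ((n.natAbs * G : ℕ) : ℝ)) /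
        (((n.natAbs * G : ℕ) : ℝ) - ((K + Q₂ : ℕ) : ℝ))) +
      1 / (((n.natAbs * G : ℕ) : ℝ) - ((K + Q₂ : ℕ) : ℝ)) + 1 / (Real.pi * (((n.natAbs * G : ℕ) : ℝ) - ((K + Q₂ : ℕ) : ℝ)) ^ 2) ≤
    4 / Real.pi + 2 / Real.pi * Real.log ((((K + Q₂ : ℕ) : ℝ) + ((Λ * G : ℕ) : ℝ)) / (((Λ * G : ℕ) : ℝ) - ((K + Q₂ : ℕ) : ℝ))) +
      1 / (((Λ * G : ℕ) : ℝ) - ((K + Q₂ : ℕ) : ℝ)) + 1 / (Real.pi * (((Λ * G : ℕ) : ℝ) - ((K + Q₂ : ℕ) : ℝ)) ^ 2) := by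
  have h1 : ((K + Q₂ : ℕ) : ℝ) < ((Λ * G : ℕ) : ℝ) := by exact_mod_cast hΛ
  have h2 : ((Λ * G : ℕ) : ℝ) ≤ ((n.natAbs * G : ℕ) : ℝ) := by
    have h : Λ ≤ n.natAbs := by rw [← Int.natCast_natAbs] at hn; exact_mod_cast hn
    exact_mod_cast Nat.mul_le_mul_right G h
  have hD' : 0 < ((Λ * G : ℕ) : ℝ) - ((K + Q₂ : ℕ) : ℝ) := by linarith
  have hx : 0 < (((K + Q₂ : ℕ) : ℝ) + ((n.natAbs * G : ℕ) : ℝ)) / (((n.natAbs * G : ℕ) : ℝ) - ((K + Q₂ : ℕ) : ℝ)) := by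
    refine div_pos ?_ (by linarith)
    have : (0 : ℝ) ≤ ((K + Q₂ : ℕ) : ℝ) := by positivity
    linarith
  exact logKernel_mono hx (stripKernel_ratio_le hΛ hn) hD' (by linarith)

/-- **The sharp kernel layer of a fibre block (strip window)**: `1/(2(|n|G − K − Q₂)) ≤ 1/(2(ΛG − K − Q₂))` for `|n| ≥ Λ`. [folklore] -/
theorem stripKernel_tauLog_le {K G Q₂ Λ : ℕ} (hΛ : K + Q₂ < Λ * G) {n : ℤ} (hn : (Λ : ℤ) ≤ |n|) :
    1 / (2 * (((n.natAbs * G : ℕ) : ℝ) - ((K + Q₂ : ℕ) : ℝ))) ≤ 1 / (2 * (((Λ * G : ℕ) : ℝ) - ((K + Q₂ : ℕ) : ℝ))) := by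
  have h1 : ((K + Q₂ : ℕ) : ℝ) < ((Λ * G : ℕ) : ℝ) := by exact_mod_cast hΛ
  have h2 : ((Λ * G : ℕ) : ℝ) ≤ ((n.natAbs * G : ℕ) : ℝ) := by
    have h : Λ ≤ n.natAbs := by rw [← Int.natCast_natAbs] at hn; exact_mod_cast hn
    exact_mod_cast Nat.mul_le_mul_right G h
  exact one_div_le_one_div_of_le (by linarith) (by linarith)

end Summit.AnomalousDissipation.AnomalousDissipation.Theorems.SawtoothPulseCascade.K1Window
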